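/-
Copyright (c) 2026 the pub-hodgecm-mathlib formalisation cell (harness21).  Prover seat hodgecm-mathlib-LH4-p07 (g4), req620 Track A «(D-RAM) FOUR-FRAME» squad
(heir LEAD F0P3a-plan lineage; dealer LH4-plan lineage WORD #26 (1); MS ROAD A, Stage B₂ brick B7₂ (iv)₂ «CORE-HANGING STRATA, TYPE 2 — THE WEIGHTED COUNT», FILE (D2₂):
the EQUILATERAL GLUE with multiplicity; Stage B lead LH4-p10 (g2)).  2026-09-04.
-/
import Summits.HodgeConjecture.HodgeConjecture.Theorems.F0P3cDyRamDiagonalCoreHangingCountTypeTwo       -- (C₂) (this seat): orbit term, `n₂` on the set, polarisable ⟺ κ-rational; brings (iii)₂(b), ★ Corner indices, ★ PolarisationCountTools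
import Summits.HodgeConjecture.HodgeConjecture.Theorems.F0P3cDyRamDiagonalCoreHangingFootTypeTwo        -- (D1₂) (this seat): stability in κ-currency at corner 2ρ+1; brings ★ p856147 (`ncard_glue_representatives_eq`, `glue_representatives_eq_empty`, `v_one_sub_glueUnit`)
import Summits.HodgeConjecture.HodgeConjecture.Theorems.F0P3cDyRamDiagonalCoreHangingGlueCount          -- ★ p856200 (this seat's g3, B7 (iv) (D2)): the type-0 template, `v_one_add_eq_one_of_glue`
import HarnessLib

/-!
# Crux `H413`, MS ROAD A, STAGE B₂ brick B7₂ (iv)₂, FILE (D2₂): the CORE-HANGING TYPE-2 stratum `H(2ρ+1)` in the EQUILATERAL-GLUE regime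
# `n₁ = n₂ = n₃ = m`, `ρ + 1 ≤ m < 2ρ + 1`: `∑ᶠ_{𝒮_H₂(ρ)} n₂·w = q^{2ρ+1−⌈(2ρ+1−m)∕2⌉}` if the glue unit is `F`-rational to depth `2ρ+1−m`, else `0`

Cell `hodgecm-mathlib` (D-0151), FLOOR 0, crux item H413 = `stmt-HodgeConjecture-24833`; lane `--supports stmt-HodgeConjecture-24833 --as helper` (count-neutral).  THEOREMS ONLY
(no `def`, no instance, no notation, no `sorry`, default heartbeats).  The type-2 twin of ★ p856200 `F0P3cDyRamDiagonalCoreHangingGlueCount` (corner `2ρ+1`; weight `n₂·w`).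
THE MATHEMATICS (LH4-p10 (g2) skeleton₂ `stub_B7_H` second summand, re-keyed on multiplicity by LH4-p11 (g2) 2026-09-04T00:53Z).  Below the tube a core-hanging type-2 frame
lattice is `T`-stable only on the EQUILATERAL foot `n₁ = n₂ = n₃ = m` ((D1₂) empties), with `ρ + 1 ≤ m` and the GLUE CONGRUENCE `κ ≡ −g₀ (𝔭^e)`, `e := 2ρ + 1 − m ∈ [1, ρ]`,
`g₀ = (β−1)∕(α−1)` the glue unit ((D1₂) `mapGL_latt_coreHangingTwo_eq_iff_kappa`); type-2 polarisable ⟺ the class of `κ` modulo `𝔭^ρ` is `F`-rational ((C₂)).  So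
`𝒮_H₂(ρ) = ⨆_{g ∈ R, |g + g₀| ≤ |ϖ|^e} 𝒯·latt V_H₂(1,1,g)` over a complete irredundant system `R` of fixed units mod `𝔭^ρ` (`|1 + g| = 1` automatically: equilateral ⇒ `|1 − g₀| = 1`,
★ `v_one_add_eq_one_of_glue`), and there are `q^{⌈ρ∕2⌉ − ⌈e∕2⌉}` such `g` if one exists (★ `ncard_glue_representatives_eq`), none otherwise.  Each orbit carries
`n₂·[𝒯 : S̃]∕[𝒰 : S_F] = q^{(ρ+2)∕2−(ρ+1)∕2}·((q−1)q^ρ)((q−1)q^{2ρ})∕(((q−1)q^{(ρ+2)∕2−1})((q−1)q^ρ))` ((C₂) `finsum_stabiliserWeight_orbit_two_eq`,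
`polarisationCount_eq_of_mem_coreHangingTwoStratum`); the product is **`q^{2ρ+1 − (2ρ+1−m+1)∕2}`** = skeleton₂ `q^{2ρ+1−(2ρ+1−n₁+1)∕2}` — the multiplicity `q` at even `ρ`
is what makes p10's letter exact (at type 0 the same letter read `q^{2ρ−⌈(2ρ−m)∕2⌉}`).
* §1 `pairwise_disjoint_orbits_two_of` (sub-systems), `coreHangingTwoStratum_eq_iUnion_orbits_glue`.
* §2 HEADS **`finsum_polarisationCount_mul_stabiliserWeight_coreHangingTwoStratum_glue`** and `…_glue_eq_zero`.
HONEST LABEL.  Count-neutral; the census laws stay PROVER TARGETS until the MS assembly lands; `HC_CM` is proved only modulo the 7 printed citations (2 remaining named inputs: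
hLiu418 = `stmt-HodgeConjecture-24832`, h413 = `stmt-HodgeConjecture-24833`) until rung 0 closes.

## References
* [Kottwitz1986BaseChangeUnits] R. Kottwitz, *Base change for unit elements of Hecke algebras*, Compositio Math. 60 (1986), §1 pp. 240–241 (lattice counts via torus orbits).
* [Rogawski1990] J. D. Rogawski, *Automorphic Representations of Unitary Groups in Three Variables*, Ann. of Math. Stud. 123 (1990), §4.9 Prop. 4.9.1 (a) p. 55.
* [Serre1979] J.-P. Serre, *Local Fields*, GTM 67, Springer (1979), Ch. IV §2 Prop. 6; Ch. I §6 Prop. 18.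
-/

set_option autoImplicit false

noncomputable section

namespace Summit.HodgeConjecture.HodgeConjecture.Cruxes.H413.F0P3cDyRamDiagonalCoreHangingGlueCountTypeTwo

open Matrix WithZero
open Literature.NumberTheory.Automorphic Literature.NumberTheory.Automorphic.HermitianLattice
open Literature.NumberTheory.Automorphic.UnitaryLatticeTree
open Literature.NumberTheory.LocalFields.WildQuadraticDatum
open Summit.HodgeConjecture.HodgeConjecture.Cruxes.H413.F0P3cDyRamDiagonalTorusDefs
open Summit.HodgeConjecture.HodgeConjecture.Cruxes.H413.F0P3cDyRamDiagonalStrataDefs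
open Summit.HodgeConjecture.HodgeConjecture.Cruxes.H413.F0P3cDyRamDiagonalGluedTorusOrbits
open Summit.HodgeConjecture.HodgeConjecture.Cruxes.H413.F0P3cDyRamDiagonalCoreHangingOrbits
open Summit.HodgeConjecture.HodgeConjecture.Cruxes.H413.F0P3cDyRamDiagonalCoreHangingFoot
open Summit.HodgeConjecture.HodgeConjecture.Cruxes.H413.F0P3cDyRamDiagonalCoreHangingGlueCount
open Summit.HodgeConjecture.HodgeConjecture.Cruxes.H413.F0P3cDyRamDiagonalGluedClassRepresentatives
open Summit.HodgeConjecture.HodgeConjecture.Cruxes.H413.F0P3cDyRamDiagonalGluedStabiliserIndex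
open Summit.HodgeConjecture.HodgeConjecture.Cruxes.H413.F0P3cDyRamDiagonalGluedStabiliserIndexFullCorner
open Summit.HodgeConjecture.HodgeConjecture.Cruxes.H413.F0P3cDyRamDiagonalGluedBoxCountCorner
open Summit.HodgeConjecture.HodgeConjecture.Cruxes.H413.F0P3cDyRamDiagonalStratumTools
open Summit.HodgeConjecture.HodgeConjecture.Cruxes.H413.F0P3cDyRamDiagonalPolarisationCountTools
open Summit.HodgeConjecture.HodgeConjecture.Cruxes.H413.F0P3cDyRamDiagonalFixedClassRefinementCount
open Summit.HodgeConjecture.HodgeConjecture.Cruxes.H413.F0P3cDyRamDiagonalCoreHangingCountTypeTwo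
open Summit.HodgeConjecture.HodgeConjecture.Cruxes.H413.F0P3cDyRamDiagonalCoreHangingFootTypeTwo
open scoped Valued WithZero Matrix MatrixGroups

variable {K : Type*} [Field K] [Valued K ℤᵐ⁰]

/-! ## §1 The EQUILATERAL GLUE: decomposition -/

/-- **ORBITS OF DISTINCT ADMISSIBLE REPRESENTATIVES ARE DISJOINT** at the corner `2ρ+1` (any sub-system `S ⊆ R` of fixed units with `|1 + g| = 1`; `κ` mod `𝔭^ρ` is a lattice
invariant, ★ `v_kappa_sub_le_of_latt_glued_corner_eq`). [cite: Kottwitz1986BaseChangeUnits, §1 pp. 240–241] -/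
theorem pairwise_disjoint_orbits_two_of {ϖ : K} (hϖ : Valued.v ϖ = exp (-1 : ℤ)) (ρ : ℕ) {R S : Set K} (hSR : S ⊆ R) (hR1 : ∀ g ∈ R, Valued.v g = 1)
    (hS1 : ∀ g ∈ S, Valued.v (1 + g) = 1) (hR3 : ∀ g ∈ R, ∀ g' ∈ R, Valued.v (g - g') ≤ Valued.v ϖ ^ ρ → g = g') :
    S.PairwiseDisjoint (fun g : K =>
      {M : Submodule 𝒪[K] (Fin 3 → K) | ∃ u ∈ unitTorus K 3,
        M = mapGL (diagGLUnits u) (latt (!![1, 0, 0; 1, ϖ ^ ρ, 0; 1 * 1 + g, ϖ ^ ρ * 1, ϖ ^ (2 * ρ + 1)] : Matrix (Fin 3) (Fin 3) K))}) := by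
  have h := pairwise_disjoint_orbits_two hϖ ρ (R := {g : K | g ∈ R ∧ Valued.v (1 + g) = 1}) (fun g hg => hR1 g hg.1)
    (fun g hg g' hg' hgg => hR3 g hg.1 g' hg'.1 hgg)
  refine h.subset fun g hg => ?_
  exact ⟨⟨hSR hg, hS1 g hg⟩, hS1 g hg⟩

/-- **THE EQUILATERAL-GLUE DECOMPOSITION OF THE CORE-HANGING TYPE-2 STRATUM INTO `𝒯`-ORBITS**: on `n₁ = n₂ = n₃ = m` with `ρ + 1 ≤ m < 2ρ + 1` (`e = 2ρ + 1 − m`),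
`𝒮_H₂(ρ) = ⋃_{g ∈ R, |g + g₀| ≤ |ϖ|^e} 𝒯·latt V_H₂(1,1,g)` (`g₀ = (β−1)∕(α−1)`; (C₂) + (D1₂)). [cite: Kottwitz1986BaseChangeUnits, §1 pp. 240–241] [cite: Rogawski1990, §4.9 Prop. 4.9.1 (a) p. 55] -/
theorem coreHangingTwoStratum_eq_iUnion_orbits_glue {σ : K →+* K} (hσ : ∀ a, σ (σ a) = a) (hvσ : ∀ a, Valued.v (σ a) = Valued.v a)
    {ϖ : K} (hϖ : Valued.v ϖ = exp (-1 : ℤ)) (hTr : ∀ a : K, Valued.v (a + σ a) ≤ Valued.v ϖ * Valued.v a)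
    (T : GL (Fin 3) K) {α β : K} (hT : (T : Matrix (Fin 3) (Fin 3) K) = Matrix.diagonal ![α, β, 1]) (hα : Valued.v α = 1) (hβ : Valued.v β = 1)
    {m : ℕ} (h₁ : Valued.v (β - 1) = Valued.v ϖ ^ m) (h₂ : Valued.v (α - 1) = Valued.v ϖ ^ m) (h₃ : Valued.v (β - α) = Valued.v ϖ ^ m)
    {ρ : ℕ} (hρ : 1 ≤ ρ) (hρm : ρ + 1 ≤ m) (hm : m < 2 * ρ + 1)
    {R : Set K} (hR1 : ∀ g ∈ R, σ g = g ∧ Valued.v g = 1) (hR2 : ∀ f : K, σ f = f → Valued.v f = 1 → ∃ g ∈ R, Valued.v (f - g) ≤ Valued.v ϖ ^ ρ) :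
    {M : Submodule 𝒪[K] (Fin 3 → K) | M ∈ normalisedStableLattices T ∧ IsTypeTwoPolarisable σ ϖ M ∧
        ∃ x ζ y'' : K, Valued.v x = 1 ∧ Valued.v ζ = 1 ∧ Valued.v y'' = 1 ∧ Valued.v (x * ζ + y'') = 1 ∧
          M = latt (!![1, 0, 0; x, ϖ ^ ρ, 0; x * ζ + y'', ϖ ^ ρ * ζ, ϖ ^ (2 * ρ + 1)] : Matrix (Fin 3) (Fin 3) K)} =
      ⋃ g ∈ {g : K | g ∈ R ∧ Valued.v (g + (β - 1) / (α - 1)) ≤ Valued.v ϖ ^ (2 * ρ + 1 - m)},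
        {M | ∃ u ∈ unitTorus K 3, M = mapGL (diagGLUnits u) (latt (!![1, 0, 0; 1, ϖ ^ ρ, 0; 1 * 1 + g, ϖ ^ ρ * 1, ϖ ^ (2 * ρ + 1)] : Matrix (Fin 3) (Fin 3) K))} := by
  obtain ⟨hϖ0, hϖ1⟩ := ne_zero_and_v_lt_one_of_v_eq_exp hϖ
  have hpρ : ϖ ^ ρ ≠ 0 := pow_ne_zero _ hϖ0
  have hpr : ϖ ^ (2 * ρ + 1) ≠ 0 := pow_ne_zero _ hϖ0
  have he1 : 1 ≤ 2 * ρ + 1 - m := by omega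
  have hρe : Valued.v ϖ ^ ρ ≤ Valued.v ϖ ^ (2 * ρ + 1 - m) := by rw [v_varpi_pow hϖ, v_varpi_pow hϖ, exp_le_exp]; omega
  ext M
  simp only [Set.mem_setOf_eq, Set.mem_iUnion, exists_prop]
  constructor
  · rintro ⟨⟨-, hTM, -⟩, hpol, x, ζ, y'', hx, hζ, hy'', hy, rfl⟩
    obtain ⟨V, hV⟩ := exists_gl_coe_eq_glued x ζ y'' hpρ hpr
    rw [← hV] at hpol hTM
    obtain ⟨-, -, hS3⟩ := (mapGL_latt_coreHangingTwo_eq_iff_kappa hϖ hα hβ T hT h₁ h₂ h₃ ρ hx hζ hy'' V hV).1 hTM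
    obtain ⟨f, hσf, hκf⟩ := (isTypeTwoPolarisable_latt_coreHangingTwo_iff_exists_fixed_kappa hσ hvσ hϖ0 hϖ1 hTr ρ hρ hx hζ hy'' hy V hV).1 hpol
    obtain ⟨hvf, -⟩ := fixed_kappa_unit_letters hϖ1 hρ hx hζ hy'' hy hκf
    obtain ⟨g, hgR, hfg⟩ := hR2 f hσf hvf
    have hκg : Valued.v (y'' / (x * ζ) - g) ≤ Valued.v ϖ ^ ρ := by
      have e : y'' / (x * ζ) - g = (y'' / (x * ζ) - f) + (f - g) := by ring
      rw [e]; exact Valuation.map_add_le _ hκf hfg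
    have hge : Valued.v (g + (β - 1) / (α - 1)) ≤ Valued.v ϖ ^ (2 * ρ + 1 - m) := by
      rw [show g + (β - 1) / (α - 1) = (y'' / (x * ζ) + (β - 1) / (α - 1)) - (y'' / (x * ζ) - g) by ring]
      exact Valuation.map_sub_le _ hS3 (hκg.trans hρe)
    obtain ⟨V₀, hV₀⟩ := exists_gl_coe_eq_glued (1 : K) 1 g hpρ hpr
    have hy''0 : Valued.v y'' = Valued.v ϖ ^ 0 := by rw [pow_zero]; exact hy''
    have hg0 : Valued.v g = Valued.v ϖ ^ 0 := by rw [pow_zero]; exact (hR1 g hgR).2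
    have hκg0 : Valued.v (y'' / (x * ζ) - g) ≤ Valued.v ϖ ^ (ρ + 0) := by rw [Nat.add_zero]; exact hκg
    obtain ⟨u, hu, hM⟩ := exists_mem_unitTorus_latt_glued_corner_eq_mapGL hϖ0 ρ 0 hx hζ hy''0 hg0 hκg0 hpr V₀ hV₀
    exact ⟨g, ⟨hgR, hge⟩, u, hu, by rw [hM, hV₀]⟩
  · rintro ⟨g, ⟨hgR, hge⟩, u, hu, rfl⟩
    obtain ⟨hσg, hvg⟩ := hR1 g hgR
    have h1g : Valued.v (1 + g) = 1 := v_one_add_eq_one_of_glue hϖ h₂ h₃ he1 hge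
    obtain ⟨V₀, hV₀⟩ := exists_gl_coe_eq_glued (1 : K) 1 g hpρ hpr
    obtain ⟨x', ζ', y₁, hx', hζ', hy₁, hy', hκ, hM⟩ := exists_coreHanging_of_mem_orbit u hu hvg h1g (ϖ ^ ρ) (ϖ ^ (2 * ρ + 1)) V₀ hV₀
    rw [← hV₀, hM]
    obtain ⟨V, hV⟩ := exists_gl_coe_eq_glued x' ζ' y₁ hpρ hpr
    refine ⟨⟨⟨V, by rw [hV]⟩, ?_, isNormalisedLattice_latt_coreHangingTwo hϖ1.le ρ hx' hζ' hy'⟩, ?_, x', ζ', y₁, hx', hζ', hy₁, hy', rfl⟩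
    · rw [← hV]
      exact (mapGL_latt_coreHangingTwo_eq_iff_kappa hϖ hα hβ T hT h₁ h₂ h₃ ρ hx' hζ' hy₁ V hV).2 ⟨by omega, hρm, by rw [hκ]; exact hge⟩
    · rw [← hV]
      exact (isTypeTwoPolarisable_latt_coreHangingTwo_iff_exists_fixed_kappa hσ hvσ hϖ0 hϖ1 hTr ρ hρ hx' hζ' hy₁ hy' V hV).2
        ⟨g, hσg, by rw [hκ, sub_self, map_zero]; exact zero_le⟩

/-! ## §2 HEADS — the glue count with multiplicity, and the zero case -/

/-- **B7₂ (iv)₂, EQUILATERAL GLUE — THE n₂-WEIGHTED COUNT IS `q^{2ρ+1 − ⌈(2ρ+1−m)∕2⌉}`.**  Datum letters with the wild trace bound, finite residue field (`q = #𝓀`), `T = diag(α, β, 1)`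
with unit entries on the EQUILATERAL foot `|β−1| = |α−1| = |β−α| = |ϖ|^m`, `1 ≤ ρ`, `ρ + 1 ≤ m < 2ρ + 1`, and a FIXED `f₀` with `|f₀ + (β−1)∕(α−1)| ≤ |ϖ|^{2ρ+1−m}` (the glue unit is
`F`-rational to depth `2ρ+1−m`; ★ `exists_fixed_near_glueUnit_iff_le` ⟺ `2ρ+1−m ≤ m−d+1`):  `∑ᶠ_{M ∈ 𝒮_H₂(ρ)} n₂(M)·w(M) = q^{2ρ+1 − (2ρ+1−m+1)∕2}` — skeleton₂
`stub_B7_H`'s glue summand `q^{2ρ+1−(2ρ+1−n₁+1)∕2}` VERBATIM. [cite: Rogawski1990, §4.9 Prop. 4.9.1 (a) p. 55] [cite: Kottwitz1986BaseChangeUnits, §1 pp. 240–241] -/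
theorem finsum_polarisationCount_mul_stabiliserWeight_coreHangingTwoStratum_glue {σ : K →+* K} (hσ : ∀ a, σ (σ a) = a) (hvσ : ∀ a, Valued.v (σ a) = Valued.v a)
    (hfix : ∀ x : K, σ x = x → x ≠ 0 → ∃ n : ℤ, Valued.v x = exp (2 * n)) {ϖ : K} (hϖ : Valued.v ϖ = exp (-1 : ℤ))
    {d : ℕ} (hd : Valued.v (ϖ - σ ϖ) = Valued.v ϖ ^ d) (hTr : ∀ a : K, Valued.v (a + σ a) ≤ Valued.v ϖ * Valued.v a) [Finite 𝓀[K]]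
    (T : GL (Fin 3) K) {α β : K} (hT : (T : Matrix (Fin 3) (Fin 3) K) = Matrix.diagonal ![α, β, 1]) (hα : Valued.v α = 1) (hβ : Valued.v β = 1)
    {m : ℕ} (h₁ : Valued.v (β - 1) = Valued.v ϖ ^ m) (h₂ : Valued.v (α - 1) = Valued.v ϖ ^ m) (h₃ : Valued.v (β - α) = Valued.v ϖ ^ m)
    {ρ : ℕ} (hρ : 1 ≤ ρ) (hρm : ρ + 1 ≤ m) (hm : m < 2 * ρ + 1)
    {f₀ : K} (hσf₀ : σ f₀ = f₀) (hf₀ : Valued.v (f₀ + (β - 1) / (α - 1)) ≤ Valued.v ϖ ^ (2 * ρ + 1 - m)) :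
    ∑ᶠ M ∈ {M : Submodule 𝒪[K] (Fin 3 → K) | M ∈ normalisedStableLattices T ∧ IsTypeTwoPolarisable σ ϖ M ∧
        ∃ x ζ y'' : K, Valued.v x = 1 ∧ Valued.v ζ = 1 ∧ Valued.v y'' = 1 ∧ Valued.v (x * ζ + y'') = 1 ∧
          M = latt (!![1, 0, 0; x, ϖ ^ ρ, 0; x * ζ + y'', ϖ ^ ρ * ζ, ϖ ^ (2 * ρ + 1)] : Matrix (Fin 3) (Fin 3) K)},
        (polarisationCount σ ϖ 2 M : ℚ) * stabiliserWeight σ M =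
      (Nat.card 𝓀[K] : ℚ) ^ (2 * ρ + 1 - (2 * ρ + 1 - m + 1) / 2) := by
  obtain ⟨hϖ0, hϖ1⟩ := ne_zero_and_v_lt_one_of_v_eq_exp hϖ
  have hvϖ : 0 < Valued.v ϖ := (Valuation.pos_iff _).2 hϖ0
  have hq : 1 < Nat.card 𝓀[K] := Finite.one_lt_card
  have he1 : 1 ≤ 2 * ρ + 1 - m := by omega
  have heρ : 2 * ρ + 1 - m ≤ ρ := by omega
  -- the multiplicity is constant on the stratum
  rw [finsum_mem_mul_eq_of_forall_eq (fun M => polarisationCount σ ϖ 2 M) (stabiliserWeight σ) (Nat.card 𝓀[K] ^ ((ρ + 2) / 2 - (ρ + 1) / 2))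
    (fun M hM => polarisationCount_eq_of_mem_coreHangingTwoStratum hσ hvσ hfix hϖ hd hTr T hρ hM)]
  -- `|g₀| = 1`
  have hα1 : α - 1 ≠ 0 := fun h0 => by rw [h0, map_zero] at h₂; exact pow_ne_zero _ hvϖ.ne' h₂.symm
  have hg₀ : Valued.v ((β - 1) / (α - 1)) = 1 := by rw [map_div₀, h₁, h₂, div_self (pow_ne_zero _ hvϖ.ne')]
  -- representatives and the glue ones (★ (D1) §1 of the type-0 chain, frame-free)
  obtain ⟨R, hRfin, -, hR1, hR2, hR3⟩ := exists_fixed_class_representatives hσ hvσ hfix hϖ hd ρ 0 hρ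
  simp only [Nat.mul_zero, pow_zero, Nat.add_zero] at hR1 hR2 hR3
  have hglue := ncard_glue_representatives_eq hσ hvσ hfix hϖ hd he1 heρ hRfin hR1 hR2 hR3 hg₀ hσf₀ hf₀
  have hRgfin : {g : K | g ∈ R ∧ Valued.v (g + (β - 1) / (α - 1)) ≤ Valued.v ϖ ^ (2 * ρ + 1 - m)}.Finite := hRfin.subset (Set.sep_subset _ _)
  rw [coreHangingTwoStratum_eq_iUnion_orbits_glue hσ hvσ hϖ hTr T hT hα hβ h₁ h₂ h₃ hρ hρm hm hR1 hR2,
    finsum_mem_biUnion (pairwise_disjoint_orbits_two_of hϖ ρ (Set.sep_subset _ _) (fun g hg => (hR1 g hg).2)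
      (fun g hg => v_one_add_eq_one_of_glue hϖ h₂ h₃ he1 hg.2) hR3) hRgfin ?_]
  · rw [finsum_mem_eq_ncard_mul hRgfin _ _ (fun g hg => finsum_stabiliserWeight_orbit_two_eq hσ hvσ hfix hϖ hd hρ (hR1 _ hg.1).1 (hR1 _ hg.1).2), hglue]
    -- arithmetic
    have hq1 : ((Nat.card 𝓀[K] : ℚ) - 1) ≠ 0 := by
      have : (1 : ℚ) < Nat.card 𝓀[K] := by exact_mod_cast hq
      linarith
    have hq0 : (Nat.card 𝓀[K] : ℚ) ≠ 0 := by exact_mod_cast (by omega : Nat.card 𝓀[K] ≠ 0)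
    have hden : ((((Nat.card 𝓀[K] - 1) * Nat.card 𝓀[K] ^ ((ρ + 2) / 2 - 1)) * ((Nat.card 𝓀[K] - 1) * Nat.card 𝓀[K] ^ ρ) : ℕ) : ℚ) ≠ 0 := by
      push_cast [Nat.cast_sub hq.le]
      exact mul_ne_zero (mul_ne_zero hq1 (pow_ne_zero _ hq0)) (mul_ne_zero hq1 (pow_ne_zero _ hq0))
    rw [← mul_assoc, ← mul_assoc, mul_inv_eq_iff_eq_mul₀ hden]
    have key : (Nat.card 𝓀[K] : ℚ) ^ ((ρ + 2) / 2 - (ρ + 1) / 2) * (Nat.card 𝓀[K] : ℚ) ^ ((ρ + 1) / 2 - (2 * ρ + 1 - m + 1) / 2) *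
        (Nat.card 𝓀[K] : ℚ) ^ ρ * (Nat.card 𝓀[K] : ℚ) ^ (2 * ρ) =
        (Nat.card 𝓀[K] : ℚ) ^ (2 * ρ + 1 - (2 * ρ + 1 - m + 1) / 2) * (Nat.card 𝓀[K] : ℚ) ^ ((ρ + 2) / 2 - 1) * (Nat.card 𝓀[K] : ℚ) ^ ρ := by
      rw [← pow_add, ← pow_add, ← pow_add, ← pow_add, ← pow_add]
      congr 1
      omega
    push_cast [Nat.cast_sub hq.le]
    linear_combination ((Nat.card 𝓀[K] : ℚ) - 1) ^ 2 * key
  · intro g hg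
    obtain ⟨V₀, hV₀⟩ := exists_gl_coe_eq_glued (1 : K) 1 g (pow_ne_zero ρ hϖ0) (pow_ne_zero (2 * ρ + 1) hϖ0)
    have hV0 : (V₀ : Matrix (Fin 3) (Fin 3) K) = !![1, 0, 0; 1, ϖ ^ ρ, 0; 1 * 1 + g, ϖ ^ ρ * 1, ϖ ^ (2 * ρ + 1 + 0)] := by rw [Nat.add_zero]; exact hV₀
    have hcard := ncard_unitTorus_orbit_latt_glued_typeTwo_eq hϖ hρ 0 (map_one _) (map_one _) (by rw [pow_zero]; exact (hR1 _ hg.1).2) V₀ hV0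
    rw [← hV₀]
    refine Set.finite_of_ncard_ne_zero ?_
    rw [hcard]
    exact mul_ne_zero (mul_ne_zero (by omega) (pow_ne_zero _ (by omega))) (mul_ne_zero (by omega) (pow_ne_zero _ (by omega)))

/-- **B7₂ (iv)₂, EQUILATERAL foot, glue unit NOT `F`-rational to depth `2ρ+1−m`: the weighted count is `0`** (no orbit qualifies). [cite: Kottwitz1986BaseChangeUnits, §1 pp. 240–241] -/
theorem finsum_polarisationCount_mul_stabiliserWeight_coreHangingTwoStratum_glue_eq_zero {σ : K →+* K} (hσ : ∀ a, σ (σ a) = a)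
    (hvσ : ∀ a, Valued.v (σ a) = Valued.v a) (hfix : ∀ x : K, σ x = x → x ≠ 0 → ∃ n : ℤ, Valued.v x = exp (2 * n)) {ϖ : K} (hϖ : Valued.v ϖ = exp (-1 : ℤ))
    {d : ℕ} (hd : Valued.v (ϖ - σ ϖ) = Valued.v ϖ ^ d) (hTr : ∀ a : K, Valued.v (a + σ a) ≤ Valued.v ϖ * Valued.v a) [Finite 𝓀[K]]
    (T : GL (Fin 3) K) {α β : K} (hT : (T : Matrix (Fin 3) (Fin 3) K) = Matrix.diagonal ![α, β, 1]) (hα : Valued.v α = 1) (hβ : Valued.v β = 1)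
    {m : ℕ} (h₁ : Valued.v (β - 1) = Valued.v ϖ ^ m) (h₂ : Valued.v (α - 1) = Valued.v ϖ ^ m) (h₃ : Valued.v (β - α) = Valued.v ϖ ^ m)
    {ρ : ℕ} (hρ : 1 ≤ ρ) (hρm : ρ + 1 ≤ m) (hm : m < 2 * ρ + 1)
    (hno : ¬ ∃ f : K, σ f = f ∧ Valued.v (f + (β - 1) / (α - 1)) ≤ Valued.v ϖ ^ (2 * ρ + 1 - m)) :
    ∑ᶠ M ∈ {M : Submodule 𝒪[K] (Fin 3 → K) | M ∈ normalisedStableLattices T ∧ IsTypeTwoPolarisable σ ϖ M ∧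
        ∃ x ζ y'' : K, Valued.v x = 1 ∧ Valued.v ζ = 1 ∧ Valued.v y'' = 1 ∧ Valued.v (x * ζ + y'') = 1 ∧
          M = latt (!![1, 0, 0; x, ϖ ^ ρ, 0; x * ζ + y'', ϖ ^ ρ * ζ, ϖ ^ (2 * ρ + 1)] : Matrix (Fin 3) (Fin 3) K)},
        (polarisationCount σ ϖ 2 M : ℚ) * stabiliserWeight σ M = 0 := by
  obtain ⟨R, -, -, hR1, hR2, -⟩ := exists_fixed_class_representatives hσ hvσ hfix hϖ hd ρ 0 hρ
  simp only [Nat.mul_zero, pow_zero, Nat.add_zero] at hR1 hR2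
  rw [coreHangingTwoStratum_eq_iUnion_orbits_glue hσ hvσ hϖ hTr T hT hα hβ h₁ h₂ h₃ hρ hρm hm hR1 hR2,
    show {g : K | g ∈ R ∧ Valued.v (g + (β - 1) / (α - 1)) ≤ Valued.v ϖ ^ (2 * ρ + 1 - m)} = ∅ from glue_representatives_eq_empty hR1 hno]
  simp

end Summit.HodgeConjecture.HodgeConjecture.Cruxes.H413.F0P3cDyRamDiagonalCoreHangingGlueCountTypeTwo

end
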